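import Literature.Computability.Complexity.CodeFPArith
import HarnessLib

/-!
# Crux `ArithStatLadder.IqThreeNotBPP` (stmt-QuantumAdvantage-14864)

Stub `stub_orQueryFP` of the line `Sketch` (UNIFORM SQUAREFREE-FILTER DOMINATION): the block-seed
query generator of the closure machine "`BPP` is closed downwards under one-sided randomized
polynomial-time reductions" is an `FP` string function.

In round `i = |acc|` (the number of answer bits received so far) the machine, on `⟨⟨x, R⟩, acc⟩`,
asks the query `f ⟨x, blockᵢ(R)⟩` with `blockᵢ(R) = (R ⇂ i·ℓ(|x|)) ↾ ℓ(|x|)` the `i`-th seed block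
of the coin string `R`. The witness is an explicit composition in the tree's typed `CodeFP`
algebra (`CodeFP.lean`, `CodeFPArith.lean`): `ℓ(|x|)` in unary by `Plumb.polyFn`, the drop count
`|acc|·ℓ(|x|)` in binary (`CodeFP.natMul`) converted back to unary CAPPED by `|R|`
(`CodeFP.unOfNatMin`; dropping `≥ |R|` symbols gives `ε` either way), then `CodeFP.strDrop`,
`CodeFP.strTake`, the pair with `x`, and finally `f`.
-/

noncomputable section

set_option linter.dupNamespace false -- D-0017: single-problem summit ⇒ `QuantumAdvantage.QuantumAdvantage` by design

namespace Summit.QuantumAdvantage.QuantumAdvantage.Theorems.IqThreeNotBPP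

open _root_.Computability Polynomial Literature.Computability.Complexity
open Literature.Computability.Complexity.CodeFP (strE unE natE pairE)

/-- A fixed polynomial of the length of a string, in unary (`Plumb.polyFn`). [folklore] -/
private theorem codeFP_polyLen (ℓ : Polynomial ℕ) :
    CodeFP strE unE (fun w : List Bool => ℓ.eval w.length) :=
  CodeFP.of_fn (Plumb.polyFn ℓ) (Plumb.polyFn_mem_FP ℓ) fun w => by
    rw [Plumb.polyFn_apply, CodeFP.unE_eq_ones]; rfl

/-- **The capped seed block** `((x, R), acc) ↦ (R ⇂ min(|acc|·ℓ(|x|), |R|)) ↾ ℓ(|x|)`, which is the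
`|acc|`-th block `(R ⇂ |acc|·ℓ(|x|)) ↾ ℓ(|x|)` of `R`, is computed on codes in polynomial time.
[folklore] -/
private theorem codeFP_block (ℓ : Polynomial ℕ) :
    CodeFP (pairE (pairE strE strE) strE) strE
      (fun a : (List Bool × List Bool) × List Bool =>
        (a.1.2.drop (a.2.length * ℓ.eval a.1.1.length)).take (ℓ.eval a.1.1.length)) := by
  -- the projections of the context `((x, R), acc)`
  have hx : CodeFP (pairE (pairE strE strE) strE) strE
      (fun a : (List Bool × List Bool) × List Bool => a.1.1) := (CodeFP.fst _ _).fst'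
  have hR : CodeFP (pairE (pairE strE strE) strE) strE
      (fun a : (List Bool × List Bool) × List Bool => a.1.2) := (CodeFP.fst _ _).snd'
  have hacc : CodeFP (pairE (pairE strE strE) strE) strE
      (fun a : (List Bool × List Bool) × List Bool => a.2) := CodeFP.snd _ _
  -- `ℓ(|x|)` in unary
  have hℓ : CodeFP (pairE (pairE strE strE) strE) unE
      (fun a : (List Bool × List Bool) × List Bool => ℓ.eval a.1.1.length) :=
    (codeFP_polyLen ℓ).comp hx
  -- the capped drop count `min (|acc|·ℓ(|x|)) |R|` in unary (product in binary, capped conversion)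
  have hcnt : CodeFP (pairE (pairE strE strE) strE) unE
      (fun a : (List Bool × List Bool) × List Bool =>
        min (a.2.length * ℓ.eval a.1.1.length) a.1.2.length) :=
    CodeFP.unOfNatMin.comp ((CodeFP.strLength.comp hR).pair
      (CodeFP.natMul.comp ((CodeFP.strNatLength.comp hacc).pair (CodeFP.natOfUn.comp hℓ))))
  refine (CodeFP.strTake.comp (hℓ.pair (CodeFP.strDrop.comp (hcnt.pair hR)))).congr fun a => ?_
  simp only
  congr 1
  by_cases h : a.2.length * ℓ.eval a.1.1.length ≤ a.1.2.length
  · rw [min_eq_left h]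
  · rw [min_eq_right (not_le.mp h).le, List.drop_length, List.drop_eq_nil_of_le (not_le.mp h).le]

/-- **The block-seed query map** `((x, R), acc) ↦ f ⟨x, (R ⇂ |acc|·ℓ(|x|)) ↾ ℓ(|x|)⟩` is computed
on codes in polynomial time, for `f ∈ FP`. [folklore] -/
private theorem codeFP_orQuery (f : List Bool → List Bool) (hf : f ∈ FP) (ℓ : Polynomial ℕ) :
    CodeFP (pairE (pairE strE strE) strE) strE
      (fun a : (List Bool × List Bool) × List Bool =>
        f (boolPair a.1.1 ((a.1.2.drop (a.2.length * ℓ.eval a.1.1.length)).take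
          (ℓ.eval a.1.1.length)))) := by
  have hx : CodeFP (pairE (pairE strE strE) strE) strE
      (fun a : (List Bool × List Bool) × List Bool => a.1.1) := (CodeFP.fst _ _).fst'
  -- the query `⟨x, block⟩` as a string (the pair code of two strings is their `boolPair`)
  have hq : CodeFP (pairE (pairE strE strE) strE) strE
      (fun a : (List Bool × List Bool) × List Bool =>
        boolPair a.1.1 ((a.1.2.drop (a.2.length * ℓ.eval a.1.1.length)).take
          (ℓ.eval a.1.1.length))) :=
    (hx.pair (codeFP_block ℓ)).recodeOut fun _ => rfl
  have hf' : CodeFP strE strE f := CodeFP.of_fn f hf fun _ => rfl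
  exact hf'.comp hq

/-- **STUB Q · `stub_orQueryFP`** (CodeFP algebra): for `f ∈ FP` and a polynomial `ℓ`, the
block-seed query generator `⟨⟨x, R⟩, acc⟩ ↦ f ⟨x, (R ⇂ |acc|·ℓ(|x|)) ↾ ℓ(|x|)⟩` of the closure
machine (round `i = |acc|` reads the `i`-th seed block of the coins `R`) is an `FP` string
function. -/
theorem stub_orQueryFP :
    ∀ (f : List Bool → List Bool), f ∈ FP → ∀ ℓ : Polynomial ℕ,
      ∃ Qg : List Bool → List Bool, Qg ∈ FP ∧
        ∀ x R acc : List Bool,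
          Qg (boolPair (boolPair x R) acc) =
            f (boolPair x ((R.drop (acc.length * ℓ.eval x.length)).take (ℓ.eval x.length))) := by
  intro f hf ℓ
  obtain ⟨Qg, hQg, hval⟩ := codeFP_orQuery f hf ℓ
  exact ⟨Qg, hQg, fun x R acc => hval ((x, R), acc)⟩

end Summit.QuantumAdvantage.QuantumAdvantage.Theorems.IqThreeNotBPP

end
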